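import Literature.Analysis.FluidPDE.PassiveScalarMaximumPrinciple
import Literature.Analysis.FluidPDE.PassiveScalarHalfOpenExistence
import Literature.Analysis.FunctionSpaces.TorusFourierCalculus
import Literature.Analysis.FunctionSpaces.TorusSobolevNormFacts
import Summits.AnomalousDissipation.AnomalousDissipation.Theorems.ScalarAnomalySteadySourceFormal.Negative.ScalarTimeShift

/-!
# K1loc, line `Spectral` / SeqCone — helper: RESTART AT A SLOT BOUNDARY (linear good-piece / zone-junk split)

Helper file of the prover lane on the crux `K1LocalisedCascade` (stmt-AnomalousDissipation-19491), route
`SawtoothPulseCascade` (memo v4 `K1loc-slot-lemma-memo-v4-k1locp1g2.md` §2, "linear good-piece propagation").  The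
tree has classical well-posedness of `∂ₜθ + u·∇θ = κΔθ` on closed windows (Krylov 9.2.3 proved:
`…Negative.ScalarTimeShift.exists_isClassicalScalarTransportOn_Icc`, uniqueness `IsClassicalScalarTransportOn.eq_of_eq`),
linearity (`….sub`, `….neg`), `L²` contraction (`antitoneOn_scalarL2Sq`) and the maximum principle
(`abs_le_of_forall_abs_init_le`).  Hence at every slot boundary `a` a classical solution `θ` on `[a,b]` SPLITS
LINEARLY along a smooth cut-off `X`:

* `exists_restart_split` — `θ = θ₁ + θ₂` on `[a,b]` with classical `θ₁` from `X·θ(a)` ("good piece") and `θ₂` from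
  `(1 − X)·θ(a)` ("zone junk");
* `junk_scalarL2Sq_le` — `‖θ₂(t)‖² ≤ ‖(1−X)θ(a)‖² ≤ (sup|θ(a)|)² ∫(1−X)²` for all `t ∈ [a,b]` (contraction; the junk is
  charged ONCE, by sup-norm × zone mass, and never tracked again);
* `good_abs_le` — `|θ₁(t,x)| ≤ sup|θ(a)|` when `|X| ≤ 1` (maximum principle: the good piece keeps the sup bound, so the
  next restart can charge its own junk the same way);
* `sqrt_tsum_symbol_sq_add_le` — weighted spectral energies are subadditive in the field
  (`√Σ w|𝓕(F+G)|² ≤ √Σ w|𝓕F|² + √(∫|G|²)` for `0 ≤ w ≤ 1`), the form in which the junk enters `√E_low`.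

This replaces the branch-summed backward symbols of memo v3 F-a/F-g (unbounded multiplicity) by ONE symbol per good
piece.  WHAT THIS IS NOT: no statement about the cascade or the stub itself; no definitions.
[cite: Krylov1996, Thm. 9.2.3 (classical Cauchy problem for second-order parabolic equations)]
[cite: JohanssonSorella2024, Lemma 2.2 (maximum principle / L² contraction for advection–diffusion)] [problem: turb]
-/

-- `Summit.<Summit>.<Problem>`: single-conjunct summit, the duplicate namespace segment is deliberate.
set_option linter.dupNamespace false

noncomputable section

namespace Summit.AnomalousDissipation.AnomalousDissipation.Theorems.SawtoothPulseCascade.K1Slot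

open MeasureTheory Set Filter Topology UnitAddTorus Function
open scoped ContDiff
open Literature.Analysis Literature.Analysis.FunctionSpaces Literature.Analysis.FunctionSpaces.Torus
open Summit.AnomalousDissipation.AnomalousDissipation.Theorems.ScalarAnomalySteadySourceFormal.Negative

section Restart

variable {d : Type*} [Fintype d] [DecidableEq d]
variable {κ a b : ℝ} {u : ℝ → UnitAddTorus d → EuclideanSpace ℝ d} {θ : ℝ → UnitAddTorus d → ℝ}

/-- **Linear split at a slot boundary.** For `κ > 0`, a classical solution `θ` on `[a,b]` (`a < b`) and a smooth
cut-off `X`, there are classical solutions `θ₁` from `X·θ(a)` and `θ₂` from `(1−X)·θ(a)` on `[a,b]` with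
`θ = θ₁ + θ₂` there (existence twice, linearity, uniqueness). [cite: Krylov1996, Thm. 9.2.3] -/
theorem exists_restart_split (hκ : 0 < κ) (hab : a < b)
    (hθ : FluidPDE.Torus.IsClassicalScalarTransportOn (Icc a b) κ u θ) {X : UnitAddTorus d → ℝ} (hX : IsSmooth X) :
    ∃ θ₁ θ₂ : ℝ → UnitAddTorus d → ℝ,
      FluidPDE.Torus.IsClassicalScalarTransportOn (Icc a b) κ u θ₁ ∧ θ₁ a = (fun x => X x * θ a x) ∧
      FluidPDE.Torus.IsClassicalScalarTransportOn (Icc a b) κ u θ₂ ∧ θ₂ a = (fun x => (1 - X x) * θ a x) ∧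
      ∀ t ∈ Icc a b, θ t = fun x => θ₁ t x + θ₂ t x := by
  have hθa : IsSmooth (θ a) := hθ.smooth_scalar.isSmooth_slice (left_mem_Icc.2 hab.le)
  have hd1 : IsSmooth (fun x => X x * θ a x) := hX.mul hθa
  have hd2 : IsSmooth (fun x => (1 - X x) * θ a x) := ((isSmooth_const (1 : ℝ)).sub hX).mul hθa
  obtain ⟨θ₁, h₁, h₁a⟩ := exists_isClassicalScalarTransportOn_Icc hκ hab hθ.smooth_velocity hθ.divFree hd1
  obtain ⟨θ₂, h₂, h₂a⟩ := exists_isClassicalScalarTransportOn_Icc hκ hab hθ.smooth_velocity hθ.divFree hd2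
  refine ⟨θ₁, θ₂, h₁, h₁a, h₂, h₂a, fun t ht => ?_⟩
  -- `θ₁ + θ₂ = θ₁ - (-θ₂)` is a classical solution with the same datum as `θ`
  have hU : UniqueDiffOn ℝ (Icc a b) := uniqueDiffOn_Icc hab
  have hsum : FluidPDE.Torus.IsClassicalScalarTransportOn (Icc a b) κ u (fun t x => θ₁ t x - -θ₂ t x) :=
    FluidPDE.Torus.IsClassicalScalarTransportOn.sub hU h₁ (h₂.neg hU)
  have h0 : (fun x => θ₁ a x - -θ₂ a x) = θ a := by
    funext x; rw [h₁a, h₂a]; ring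
  have heq := FluidPDE.Torus.IsClassicalScalarTransportOn.eq_of_eq hκ.le hsum hθ h0 ht
  rw [← heq]
  funext x; ring

/-- **The zone junk is charged once**: `‖θ₂(t)‖² ≤ ‖(1−X)θ(a)‖² ≤ M²∫(1−X)²` for `t ∈ [a,b]`, `|θ(a)| ≤ M`
(`L²` contraction). [cite: JohanssonSorella2024, Lemma 2.2] -/
theorem junk_scalarL2Sq_le (hκ : 0 ≤ κ) {θ₂ : ℝ → UnitAddTorus d → ℝ}
    (h₂ : FluidPDE.Torus.IsClassicalScalarTransportOn (Icc a b) κ u θ₂) {X : UnitAddTorus d → ℝ} (hX : IsSmooth X)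
    (h₂a : θ₂ a = fun x => (1 - X x) * θ a x) {M : ℝ} (hM : ∀ x, |θ a x| ≤ M)
    {t : ℝ} (ht : t ∈ Icc a b) :
    FluidPDE.Torus.scalarL2Sq (θ₂ t) ≤ M ^ 2 * ∫ x, (1 - X x) ^ 2 := by
  have hanti := h₂.antitoneOn_scalarL2Sq hκ (a := a) (b := b) subset_rfl (left_mem_Icc.2 (ht.1.trans ht.2)) ht ht.1
  refine hanti.trans ?_
  show ∫ x, θ₂ a x ^ 2 ≤ _
  rw [h₂a, ← integral_const_mul]
  have h1X : IsSmooth (fun x => (1 - X x) ^ 2) := ((isSmooth_const (1 : ℝ)).sub hX).pow 2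
  refine integral_mono_of_nonneg (Eventually.of_forall fun x => sq_nonneg _) (h1X.integrable.const_mul _)
    (Eventually.of_forall fun x => ?_)
  simp only
  rw [mul_pow, mul_comm]
  have hMx : θ a x ^ 2 ≤ M ^ 2 := by
    rw [← sq_abs]; exact pow_le_pow_left₀ (abs_nonneg _) (hM x) 2
  exact mul_le_mul_of_nonneg_right hMx (sq_nonneg _)

/-- **The good piece keeps the sup bound**: `|θ₁(t,x)| ≤ M` on `[a,b]` if `|X| ≤ 1` and `|θ(a)| ≤ M` (maximum
principle), so the next restart charges its junk with the same `M`. [cite: JohanssonSorella2024, Lemma 2.2] -/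
theorem good_abs_le (hκ : 0 ≤ κ) {θ₁ : ℝ → UnitAddTorus d → ℝ}
    (h₁ : FluidPDE.Torus.IsClassicalScalarTransportOn (Icc a b) κ u θ₁) {X : UnitAddTorus d → ℝ}
    (hX1 : ∀ x, |X x| ≤ 1) (h₁a : θ₁ a = fun x => X x * θ a x) {M : ℝ} (hM : ∀ x, |θ a x| ≤ M)
    {t : ℝ} (ht : t ∈ Icc a b) (x : UnitAddTorus d) : |θ₁ t x| ≤ M := by
  refine h₁.abs_le_of_forall_abs_init_le hκ subset_rfl (fun y => ?_) ht x
  rw [h₁a]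
  simp only [abs_mul]
  calc |X y| * |θ a y| ≤ 1 * M := mul_le_mul (hX1 y) (hM y) (abs_nonneg _) zero_le_one
    _ = M := one_mul M

omit [DecidableEq d] in
/-- **Weighted spectral energies are subadditive**: for continuous `F, G : T^d → ℂ` and weights `0 ≤ w ≤ 1`,
`√(Σ' w|𝓕(F+G)|²) ≤ √(Σ' w|𝓕F|²) + √(∫|G|²)` (Minkowski in weighted `ℓ²`, `w ≤ 1`, Parseval) — the form in which
the junk enters the low-mode energy. [cite: Grafakos2014, Prop. 3.2.7 (3) (Parseval on `T^d`)] -/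
theorem sqrt_tsum_symbol_sq_add_le {F G : UnitAddTorus d → ℂ} (hF : Continuous F) (hG : Continuous G)
    {w : (d → ℤ) → ℝ} (hw0 : ∀ k, 0 ≤ w k) (hw1 : ∀ k, w k ≤ 1) :
    Real.sqrt (∑' k, w k * ‖mFourierCoeff (fun x => F x + G x) k‖ ^ 2) ≤
      Real.sqrt (∑' k, w k * ‖mFourierCoeff F k‖ ^ 2) + Real.sqrt (∫ x, ‖G x‖ ^ 2) := by
  have hPF := hasSum_sq_mFourierCoeff_of_continuous hF
  have hPG := hasSum_sq_mFourierCoeff_of_continuous hG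
  -- the weighted amplitudes
  set uF : (d → ℤ) → ℝ := fun k => Real.sqrt (w k) * ‖mFourierCoeff F k‖ with huF
  set uG : (d → ℤ) → ℝ := fun k => Real.sqrt (w k) * ‖mFourierCoeff G k‖ with huG
  have hwsq : ∀ k, Real.sqrt (w k) ^ 2 = w k := fun k => Real.sq_sqrt (hw0 k)
  have huF2 : ∀ k, uF k ^ 2 = w k * ‖mFourierCoeff F k‖ ^ 2 := fun k => by rw [huF]; simp only; rw [mul_pow, hwsq]
  have huG2 : ∀ k, uG k ^ 2 = w k * ‖mFourierCoeff G k‖ ^ 2 := fun k => by rw [huG]; simp only; rw [mul_pow, hwsq]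
  have hle1 : ∀ k, w k * ‖mFourierCoeff F k‖ ^ 2 ≤ ‖mFourierCoeff F k‖ ^ 2 := fun k => by
    calc w k * ‖mFourierCoeff F k‖ ^ 2 ≤ 1 * ‖mFourierCoeff F k‖ ^ 2 :=
          mul_le_mul_of_nonneg_right (hw1 k) (sq_nonneg _)
      _ = _ := one_mul _
  have hle2 : ∀ k, w k * ‖mFourierCoeff G k‖ ^ 2 ≤ ‖mFourierCoeff G k‖ ^ 2 := fun k => by
    calc w k * ‖mFourierCoeff G k‖ ^ 2 ≤ 1 * ‖mFourierCoeff G k‖ ^ 2 :=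
          mul_le_mul_of_nonneg_right (hw1 k) (sq_nonneg _)
      _ = _ := one_mul _
  have hsF : Summable fun k => uF k ^ 2 := by
    simp_rw [huF2]
    exact hPF.summable.of_nonneg_of_le (fun k => mul_nonneg (hw0 k) (sq_nonneg _)) hle1
  have hsG : Summable fun k => uG k ^ 2 := by
    simp_rw [huG2]
    exact hPG.summable.of_nonneg_of_le (fun k => mul_nonneg (hw0 k) (sq_nonneg _)) hle2
  -- Minkowski in `ℓ²`
  obtain ⟨hsum, hmink⟩ : (Summable fun k => (uF k + uG k) ^ 2) ∧
      Real.sqrt (∑' k, (uF k + uG k) ^ 2) ≤ Real.sqrt (∑' k, uF k ^ 2) + Real.sqrt (∑' k, uG k ^ 2) := by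
    have huF0 : ∀ k, 0 ≤ uF k := fun k => by positivity
    have huG0 : ∀ k, 0 ≤ uG k := fun k => by positivity
    have hu' : Summable fun k => uF k ^ (2 : ℝ) := by simpa [Real.rpow_two] using hsF
    have hv' : Summable fun k => uG k ^ (2 : ℝ) := by simpa [Real.rpow_two] using hsG
    have h := Real.Lp_add_le_tsum_of_nonneg (p := 2) (by norm_num) huF0 huG0 hu' hv'
    simp only [Real.rpow_two] at h
    exact ⟨h.1, by simpa [Real.sqrt_eq_rpow] using h.2⟩
  -- `𝓕(F+G) = 𝓕F + 𝓕G`, so the weighted amplitude of the sum is at most `uF + uG`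
  have hadd : ∀ k, mFourierCoeff (fun x => F x + G x) k = mFourierCoeff F k + mFourierCoeff G k := fun k =>
    mFourierCoeff_add hF.integrable_unitAddTorus hG.integrable_unitAddTorus k
  have hpt : ∀ k, w k * ‖mFourierCoeff (fun x => F x + G x) k‖ ^ 2 ≤ (uF k + uG k) ^ 2 := fun k => by
    rw [hadd, huF, huG]
    simp only
    rw [← mul_add, mul_pow, hwsq]
    exact mul_le_mul_of_nonneg_left (pow_le_pow_left₀ (norm_nonneg _) (norm_add_le _ _) 2) (hw0 k)
  have hsFG : Summable fun k => w k * ‖mFourierCoeff (fun x => F x + G x) k‖ ^ 2 :=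
    hsum.of_nonneg_of_le (fun k => mul_nonneg (hw0 k) (sq_nonneg _)) hpt
  have h1 : Real.sqrt (∑' k, w k * ‖mFourierCoeff (fun x => F x + G x) k‖ ^ 2) ≤
      Real.sqrt (∑' k, (uF k + uG k) ^ 2) :=
    Real.sqrt_le_sqrt (hsFG.tsum_le_tsum hpt hsum)
  have h2 : Real.sqrt (∑' k, uF k ^ 2) = Real.sqrt (∑' k, w k * ‖mFourierCoeff F k‖ ^ 2) := by
    simp_rw [huF2]
  have h3 : Real.sqrt (∑' k, uG k ^ 2) ≤ Real.sqrt (∫ x, ‖G x‖ ^ 2) := by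
    rw [← hPG.tsum_eq]
    simp_rw [huG2]
    exact Real.sqrt_le_sqrt ((hPG.summable.of_nonneg_of_le (fun k => mul_nonneg (hw0 k) (sq_nonneg _)) hle2).tsum_le_tsum
      hle2 hPG.summable)
  linarith [hmink]

end Restart

end Summit.AnomalousDissipation.AnomalousDissipation.Theorems.SawtoothPulseCascade.K1Slot
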